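import Summits.AtomisticToContinuum.Crystallization.Theorems.FrustratedLawDichotomyStrainedPatchHomEntryFitCentredReal

/-!
# Real side of the SQUARED centred pair test: `‖r‖² ≤ ‖r_c‖² + 2‖r_c‖·(T + |⟪ê,n⟫|·q₁) + (‖ΔR‖ + ‖ΔN‖)²` — first-order exact, NO singular remainder
# (27623 `(H) HomFloor (1/625)`, hcp half; hand-1 g36; critic rows 1331 (2c) / 1337 «the 2⁻⁹ bulk cell»)

decomp-a2c hand-1 g36 (crux `AperiodicFrustratedLawGap`, stmt-AtomisticToContinuum-27623).  `…CentredReal.pairResidual_le` bounds the pair residual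
`‖r_c + Δ‖` through `…CentredReal.norm_add_le_inner_add_sq`, whose remainder `‖Δ‖²/(2(‖r_c‖ − ‖Δ‖))` is singular as the box-variation bound approaches the
centre misfit `‖r_c‖` — on the `2⁻⁹` bulk cell's hull leaf `ρ_k + ρ_{k′} ≈ 0.024 ≈ ‖r_c‖ ≈ 0.025` and the inner fit verdict of record dies there although the
exact first-order budget has margin (hand-1 g36 probe Q1 / float `k2probe.py`).  The consumer only needs `‖r‖² ≤ (η′d)²`, and the SQUARE expands exactly:
`‖r_c + Δ‖² = ‖r_c‖² + 2⟪r_c, Δ⟫ + ‖Δ‖²` with the same first-order functional and the same `q₁` as `pairResidual_le`, and `‖Δ‖² ≤ (‖ΔR‖ + ‖ΔN‖)²` — no division by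
`‖r_c‖ − ‖Δ‖`.  ★★ `pairResidualSq_le` below is that statement (hypotheses: `0 < ‖r_c‖`, `‖ΔN‖ < ‖N_c‖`; the `q₂` guard of `pairResidual_le` is gone).  Since
`(A + T + P²/(2(A − P)))² ≥ A² + 2AT + P²` for `0 ≤ P < A`, `T ≥ 0`, the squared test accepts every box the linearised test accepts.

Def-free; 0 sorry; standard axioms; no instances / notation / `#eval`.  `--supports stmt-AtomisticToContinuum-27623`.
-/

namespace Summit.AtomisticToContinuum.Crystallization.Theorems.FrustratedLawDichotomyStrainedPatchHomEntryFitCentredReal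

open scoped RealInnerProductSpace
open Summit.AtomisticToContinuum.Crystallization.Theorems.ChargedEnergyGapNegative (E3)

/-- The square of the norm about a centre: `‖a + Δ‖² ≤ ‖a‖² + 2·s + P²` whenever `⟪a, Δ⟫ ≤ s` and `‖Δ‖ ≤ P`. [folklore: `‖a + Δ‖² = ‖a‖² + 2⟪a,Δ⟫ + ‖Δ‖²`] -/
theorem norm_add_sq_le_of_inner_le (a Δ : E3) {s P : ℝ} (hs : ⟪a, Δ⟫ ≤ s) (hP : ‖Δ‖ ≤ P) :
    ‖a + Δ‖ ^ 2 ≤ ‖a‖ ^ 2 + 2 * s + P ^ 2 := by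
  have e1 : ‖a + Δ‖ ^ 2 = ‖a‖ ^ 2 + 2 * ⟪a, Δ⟫ + ‖Δ‖ ^ 2 := norm_add_sq_real a Δ
  have h2 : ‖Δ‖ ^ 2 ≤ P ^ 2 := pow_le_pow_left₀ (norm_nonneg _) hP 2
  rw [e1]
  linarith

/-- ★★ **FIRST-ORDER-EXACT BOUND OF THE SQUARED PAIR RESIDUAL (no singular remainder).**  With `r := R − (‖N‖ − λ)·n`, `r_c := R_c − (‖N_c‖ − λ)·n`,
`ΔR := R − R_c`, `ΔN := N − N_c`, `‖n‖ = 1`, `0 < ‖r_c‖` and `‖ΔN‖ < ‖N_c‖`: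
`‖r‖² ≤ ‖r_c‖² + 2‖r_c‖·((⟪r_c, ΔR⟫/‖r_c‖ − (⟪r_c, n⟫/‖r_c‖)·(⟪N_c, ΔN⟫/‖N_c‖)) + |⟪r_c, n⟫/‖r_c‖|·‖ΔN‖²/(2(‖N_c‖ − ‖ΔN‖))) + (‖ΔR‖ + ‖ΔN‖)²`.
[folklore chaining: `norm_add_sq_real`, `norm_add_ge_inner`, `norm_add_le_inner_add_sq` for `‖N‖ − ‖N_c‖`] -/
theorem pairResidualSq_le (R Rc N Nc n : E3) (lam : ℝ) (hn : ‖n‖ = 1) (hrc : 0 < ‖Rc - (‖Nc‖ - lam) • n‖) (hN : ‖N - Nc‖ < ‖Nc‖) :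
    ‖R - (‖N‖ - lam) • n‖ ^ 2 ≤
      ‖Rc - (‖Nc‖ - lam) • n‖ ^ 2 +
        2 * (‖Rc - (‖Nc‖ - lam) • n‖ *
          ((⟪Rc - (‖Nc‖ - lam) • n, R - Rc⟫ / ‖Rc - (‖Nc‖ - lam) • n‖ -
              ⟪Rc - (‖Nc‖ - lam) • n, n⟫ / ‖Rc - (‖Nc‖ - lam) • n‖ * (⟪Nc, N - Nc⟫ / ‖Nc‖)) +
            |⟪Rc - (‖Nc‖ - lam) • n, n⟫ / ‖Rc - (‖Nc‖ - lam) • n‖| * (‖N - Nc‖ ^ 2 / (2 * (‖Nc‖ - ‖N - Nc‖))))) +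
        (‖R - Rc‖ + ‖N - Nc‖) ^ 2 := by
  set rc : E3 := Rc - (‖Nc‖ - lam) • n with hrcdef
  set ΔR : E3 := R - Rc with hΔR
  set ΔN : E3 := N - Nc with hΔN
  set dδ : ℝ := ‖N‖ - ‖Nc‖ with hdδ
  set Δ : E3 := ΔR - dδ • n with hΔ
  have hΔN0 := norm_nonneg ΔN
  have hNc_pos : 0 < ‖Nc‖ := lt_of_le_of_lt hΔN0 hN
  have hne : ‖rc‖ ≠ 0 := hrc.ne'
  -- the decomposition `r = r_c + Δ`
  have hdecomp : R - (‖N‖ - lam) • n = rc + Δ := by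
    simp only [hrcdef, hΔ, hΔR, hdδ, sub_smul]
    abel
  -- `|dδ| ≤ ‖ΔN‖` and the two-sided expansion of `dδ`
  have hNe : N = Nc + ΔN := by simp [hΔN]
  have hdδ_abs : |dδ| ≤ ‖ΔN‖ := by
    rw [hdδ, hNe]
    have := abs_norm_sub_norm_le (Nc + ΔN) Nc
    simpa using this
  have hdδ_lo : ⟪Nc, ΔN⟫ / ‖Nc‖ ≤ dδ := by
    have := norm_add_ge_inner Nc ΔN (norm_pos_iff.1 hNc_pos)
    rw [hdδ, hNe]; linarith
  have hdδ_hi : dδ ≤ ⟪Nc, ΔN⟫ / ‖Nc‖ + ‖ΔN‖ ^ 2 / (2 * (‖Nc‖ - ‖ΔN‖)) := by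
    have := norm_add_le_inner_add_sq Nc ΔN hN
    rw [hdδ, hNe]; linarith
  -- `‖Δ‖ ≤ ‖ΔR‖ + ‖ΔN‖`
  have hΔle : ‖Δ‖ ≤ ‖ΔR‖ + ‖ΔN‖ := by
    calc ‖Δ‖ ≤ ‖ΔR‖ + ‖dδ • n‖ := norm_sub_le _ _
      _ = ‖ΔR‖ + |dδ| := by rw [norm_smul, Real.norm_eq_abs, hn, mul_one]
      _ ≤ ‖ΔR‖ + ‖ΔN‖ := by linarith
  -- the first-order term: `⟪rc, Δ⟫ = ⟪rc, ΔR⟫ − dδ ⟪rc, n⟫ = ‖rc‖·(⟪rc, ΔR⟫/‖rc‖ − dδ·en)`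
  set en : ℝ := ⟪rc, n⟫ / ‖rc‖ with hen
  set q : ℝ := ‖ΔN‖ ^ 2 / (2 * (‖Nc‖ - ‖ΔN‖)) with hq
  have hq0 : 0 ≤ q := by rw [hq]; apply div_nonneg (sq_nonneg _); linarith
  have hinner : ⟪rc, Δ⟫ = ‖rc‖ * (⟪rc, ΔR⟫ / ‖rc‖ - dδ * en) := by
    rw [hΔ, inner_sub_right, real_inner_smul_right, hen]
    field_simp
  have hfirst : -(dδ * en) ≤ -(en * (⟪Nc, ΔN⟫ / ‖Nc‖)) + |en| * q := by
    rcases le_or_gt 0 en with hpos | hneg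
    · rw [abs_of_nonneg hpos]
      nlinarith [hdδ_lo, hpos, hq0]
    · rw [abs_of_neg hneg]
      nlinarith [hdδ_hi, hneg, hq0]
  have hs : ⟪rc, Δ⟫ ≤ ‖rc‖ * ((⟪rc, ΔR⟫ / ‖rc‖ - en * (⟪Nc, ΔN⟫ / ‖Nc‖)) + |en| * q) := by
    rw [hinner]
    exact mul_le_mul_of_nonneg_left (by linarith) hrc.le
  -- assemble
  rw [hdecomp]
  have key := norm_add_sq_le_of_inner_le rc Δ hs hΔle
  have e2 : 2 * (‖rc‖ * ((⟪rc, ΔR⟫ / ‖rc‖ - en * (⟪Nc, ΔN⟫ / ‖Nc‖)) + |en| * q)) =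
      2 * (‖rc‖ * ((⟪rc, ΔR⟫ / ‖rc‖ - ⟪rc, n⟫ / ‖rc‖ * (⟪Nc, ΔN⟫ / ‖Nc‖)) + |⟪rc, n⟫ / ‖rc‖| * (‖ΔN‖ ^ 2 / (2 * (‖Nc‖ - ‖ΔN‖))))) := by
    rw [hen, hq]
  linarith [key, e2]

end Summit.AtomisticToContinuum.Crystallization.Theorems.FrustratedLawDichotomyStrainedPatchHomEntryFitCentredReal
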